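import Mathlib
import Literature.NumberTheory.Transcendental.KZCalculus
import Literature.NumberTheory.Transcendental.SemialgebraicMapsProofs
import Literature.NumberTheory.Transcendental.KZProductIdeal
import Literature.NumberTheory.Transcendental.EllIterRepShuffle
import Literature.NumberTheory.Transcendental.KZLogCalculusProofs
import Summits.KontsevichZagierPeriods.KontsevichZagierPeriods.Theorems.TorsionLogsNeronTorsionSectorStubHaarReps
import HarnessLib

/-!
# Stub `stub_fibreNL` — crux `TorsionLogs.NeronTorsionSector`, line `registered` (block S5)

Kontsevich–Zagier's rule (3) (Newton–Leibniz along the last coordinate, `KZ.newtonLeibnizRel`) in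
the inner variable `x′` for the Haar-type band representations of the crux. On the identity
component `x > e₁` of the real curve `y² = f(x) = 4x³ − g₂x − g₃` (algebraic coefficients, `f > 0`
beyond `e₁`): over a `ℚ`-semialgebraic base `A ⊆ (e₁, ∞)` with `ℚ`-semialgebraic fibre bounds
`c < d` whose closed fibres lie in a set `J` on which the potential `Q` is `ℚ`-semialgebraic,
`Q` continuous on each closed fibre with `Q′ = −k/√f` on the open fibre, the OPEN band representation
`rS = [S, k(x′)/(√f(x)√f(x′))]`, `S = {x ∈ A, c x < x′ < d x}`, and the base representation
`rB = [A, (Q(c x) − Q(d x))/√f(x)]` differ by a relation of the KZ calculus: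

* the CLOSED band `R = [{x ∈ A, c x ≤ x′ ≤ d x}, 𝟙_S · rS.integrand]` (`KZlog.band`,
  `KZlog.isSemialgebraic_band`; the extension by zero of a semialgebraic function is semialgebraic)
  differs from `rS` by the two graphs `x′ = c x`, `x′ = d x`, which are Lebesgue-null
  (`KZ.volume_graph_eq_zero`), so `[R] − [rS] ∈ relations` by domain additivity
  (`KZ.of_sub_sum_of_mem_relations_of_subset` with a one-piece family);
* `[R] − [rB]` is ONE Newton–Leibniz move with primitive `F(x, x′) = −Q(x′)/√f(x)`:
  `∂F/∂x′ = k(x′)/(√f(x′)√f(x))` on the open fibre, `F(x, d x) − F(x, c x) = (Q(c x) − Q(d x))/√f(x)`.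

References: M. Kontsevich, D. Zagier, *Periods* (2001), §1.2 rule (3); J. Bochnak, M. Coste,
M.-F. Roy, *Real Algebraic Geometry* (1998), §2.2.
-/

noncomputable section

-- `Summit.KontsevichZagierPeriods.KontsevichZagierPeriods.…` is the tree's mandated layout (single-conjunct summit).
set_option linter.dupNamespace false

open Set MeasureTheory MvPolynomial
open Literature.NumberTheory.Transcendental Literature.ModelTheory.ExponentialFields
open Literature.NumberTheory.Transcendental.KZ

namespace Summit.KontsevichZagierPeriods.KontsevichZagierPeriods.Cruxes.NeronTorsionSector.Translation

/-- **Extension by zero of a semialgebraic function.** If `g` is `ℚ`-semialgebraic on a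
`ℚ`-semialgebraic `S ⊆ D` (`D` `ℚ`-semialgebraic), then the extension by zero `𝟙_S · g` is
`ℚ`-semialgebraic on `D`: its graph over `D` is the graph of `g` over `S` together with
`(D ∖ S) × {0}`. [cite: BochnakCosteRoy1998, §2.2] -/
theorem isSemialgebraicFunOn_indicator_of_subset {m : ℕ} {D S : Set (Fin m → ℝ)}
    {g : (Fin m → ℝ) → ℝ} (hD : IsSemialgebraic ℚ D) (hS : IsSemialgebraic ℚ S) (hSD : S ⊆ D)
    (hg : IsSemialgebraicFunOn ℚ S g) : IsSemialgebraicFunOn ℚ D (S.indicator g) := by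
  classical
  have h0 : IsSemialgebraicFunOn ℚ (D \ S) (fun _ => (0 : ℝ)) :=
    (isSemialgebraicFunOn_aeval (hD.diff hS) 0).congr fun x _ => by simp
  rw [isSemialgebraicFunOn_iff] at hg h0 ⊢
  convert hg.union h0 using 1
  ext z
  simp only [mem_setOf_eq, mem_union, Set.mem_sdiff]
  by_cases hz : Fin.init z ∈ S
  · rw [Set.indicator_of_mem hz]
    have hzD : Fin.init z ∈ D := hSD hz
    tauto
  · rw [Set.indicator_of_notMem hz]
    tauto

/-- **STUB S5 (`stub_fibreNL`) — rule (3) in the inner variable for Haar-type integrands.**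
Over a `ℚ`-semialgebraic base `A ⊆ (e₁, ∞)` with `ℚ`-semialgebraic fibre bounds `c < d` (closed fibres
inside a set `J` on which `Q` is `ℚ`-semialgebraic), a potential `Q`, continuous on each closed fibre
with `Q′ = −k/√f` on the open fibre: the band representation `[S, k(x′)/(√f(x)√f(x′))]`,
`S = {x ∈ A, c x < x′ < d x}`, is KZ-equivalent to the base representation `[A, (Q(c x) − Q(d x))/√f(x)]`
— one move of `KZ.newtonLeibnizRel` with primitive `F(x, x′) = −Q(x′)/√f(x)` on the closed band
(integrand the extension by zero of that of `S`; the closed band differs from `S` by the null graphs of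
`c`, `d`, `KZ.volume_graph_eq_zero`, discarded by `KZ.of_sub_sum_of_mem_relations_of_subset`).
[cite: KontsevichZagier2001, §1.2 rule (3)] -/
theorem stub_fibreNL :
    ∀ (g₂ g₃ e₁ : ℝ) (f k Q c d : ℝ → ℝ) (A J : Set ℝ)
      (rS : Literature.NumberTheory.Transcendental.KZ.IntegralRep 2)
      (rB : Literature.NumberTheory.Transcendental.KZ.IntegralRep 1),
    IsAlgebraic ℚ g₂ → IsAlgebraic ℚ g₃ → IsAlgebraic ℚ e₁ → (∀ x, f x = 4 * x ^ 3 - g₂ * x - g₃) →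
    (∀ x, e₁ < x → 0 < f x) →
    A ⊆ Set.Ioi e₁ → IsSemialgebraic ℚ {t : Fin 1 → ℝ | t 0 ∈ A} →
    IsSemialgebraicFunOn ℚ {t : Fin 1 → ℝ | t 0 ∈ A} (fun t => c (t 0)) →
    IsSemialgebraicFunOn ℚ {t : Fin 1 → ℝ | t 0 ∈ A} (fun t => d (t 0)) →
    (∀ x ∈ A, c x < d x) → (∀ x ∈ A, Set.Icc (c x) (d x) ⊆ J) → J ⊆ Set.Ici e₁ →
    IsSemialgebraic ℚ {t : Fin 1 → ℝ | t 0 ∈ J} →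
    IsSemialgebraicFunOn ℚ {t : Fin 1 → ℝ | t 0 ∈ J} (fun t => Q (t 0)) →
    (∀ x ∈ A, ContinuousOn Q (Set.Icc (c x) (d x))) →
    (∀ x ∈ A, ∀ x' ∈ Set.Ioo (c x) (d x), HasDerivAt Q (-(k x' / Real.sqrt (f x'))) x') →
    rS.domain = {z | z 0 ∈ A ∧ c (z 0) < z 1 ∧ z 1 < d (z 0)} →
    Set.EqOn rS.integrand (fun z => k (z 1) / (Real.sqrt (f (z 0)) * Real.sqrt (f (z 1)))) rS.domain →
    rB.domain = {t | t 0 ∈ A} →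
    Set.EqOn rB.integrand (fun t => (Q (c (t 0)) - Q (d (t 0))) / Real.sqrt (f (t 0))) rB.domain →
    Literature.NumberTheory.Transcendental.KZ.of rS - Literature.NumberTheory.Transcendental.KZ.of rB ∈
      Literature.NumberTheory.Transcendental.KZ.relations := by
  intro g₂ g₃ e₁ f k Q c d A J rS rB h₂ h₃ _he₁ hf hpos hA _hAsa hc hd hcd hJcd _hJ _hJsa hQ hQc hQd
    hSd hSi hBd hBi
  -- notation: fibre bounds on the base `rB.domain = {t | t 0 ∈ A}` and the primitive
  set a : (Fin 1 → ℝ) → ℝ := fun t => c (t 0) with ha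
  set b : (Fin 1 → ℝ) → ℝ := fun t => d (t 0) with hb
  set F : (Fin 2 → ℝ) → ℝ := fun z => -Q (z 1) / Real.sqrt (f (z 0)) with hF
  have hsnoc0 : ∀ (p : Fin 1 → ℝ) (t : ℝ), (Fin.snoc p t : Fin 2 → ℝ) 0 = p 0 := fun p t => by
    simp [Fin.snoc]
  have hsnoc1 : ∀ (p : Fin 1 → ℝ) (t : ℝ), (Fin.snoc p t : Fin 2 → ℝ) 1 = t := fun p t => by
    simp [Fin.snoc]
  have hmemS : ∀ z, z ∈ rS.domain ↔ z 0 ∈ A ∧ c (z 0) < z 1 ∧ z 1 < d (z 0) := fun z => by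
    rw [hSd, mem_setOf_eq]
  have hmemB : ∀ t, t ∈ rB.domain ↔ t 0 ∈ A := fun t => by rw [hBd, mem_setOf_eq]
  -- the base data
  have hasa : IsSemialgebraicFunOn ℚ rB.domain a := by rw [hBd]; exact hc
  have hbsa : IsSemialgebraicFunOn ℚ rB.domain b := by rw [hBd]; exact hd
  have hab : ∀ x ∈ rB.domain, a x ≤ b x := fun x hx => (hcd (x 0) ((hmemB x).1 hx)).le
  -- the closed band `{x ∈ A, c x ≤ x' ≤ d x}`
  have hDsa : IsSemialgebraic ℚ (KZlog.band rB.domain a b) := KZlog.isSemialgebraic_band hasa hbsa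
  have hDA : ∀ z ∈ KZlog.band rB.domain a b, z 0 ∈ A := fun z hz =>
    (hmemB _).1 (KZlog.mem_band.1 hz).1
  have hDJ : ∀ z ∈ KZlog.band rB.domain a b, z 1 ∈ J := fun z hz => by
    obtain ⟨hzB, h1, h2⟩ := KZlog.mem_band.1 hz
    exact hJcd (z 0) ((hmemB _).1 hzB) ⟨h1, h2⟩
  have hSD : rS.domain ⊆ KZlog.band rB.domain a b := fun z hz => by
    obtain ⟨hzA, h1, h2⟩ := (hmemS z).1 hz
    exact KZlog.mem_band.2 ⟨(hmemB _).2 hzA, h1.le, h2.le⟩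
  -- the closed band minus the open one lies in the two (null) graphs of `c` and `d`
  have hcover : KZlog.band rB.domain a b \ rS.domain ⊆
      {z : Fin 2 → ℝ | Fin.init z ∈ rB.domain ∧ z (Fin.last 1) = a (Fin.init z)} ∪
        {z : Fin 2 → ℝ | Fin.init z ∈ rB.domain ∧ z (Fin.last 1) = b (Fin.init z)} := by
    rintro z ⟨hzD, hzS⟩
    obtain ⟨hzB, h1, h2⟩ := KZlog.mem_band.1 hzD
    have hzA : z 0 ∈ A := (hmemB _).1 hzB
    rw [hmemS] at hzS
    change c (z 0) ≤ z 1 at h1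
    change z 1 ≤ d (z 0) at h2
    rcases h1.eq_or_lt with h | h
    · exact Or.inl ⟨hzB, h.symm⟩
    · rcases h2.eq_or_lt with h' | h'
      · exact Or.inr ⟨hzB, h'⟩
      · exact (hzS ⟨hzA, h, h'⟩).elim
  have hnull : volume (KZlog.band rB.domain a b \ rS.domain) = 0 :=
    measure_mono_null hcover
      (measure_union_null (volume_graph_eq_zero hasa) (volume_graph_eq_zero hbsa))
  -- the band integrand: the extension by zero of the integrand of `rS`
  have hGsa : IsSemialgebraicFunOn ℚ (KZlog.band rB.domain a b) (rS.domain.indicator rS.integrand) :=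
    isSemialgebraicFunOn_indicator_of_subset hDsa rS.isSemialgebraic_domain hSD
      rS.isSemialgebraicFunOn_integrand
  have hmeasS : MeasurableSet rS.domain := IsSemialgebraic.measurableSet_holds rS.isSemialgebraic_domain
  have hGint : IntegrableOn (rS.domain.indicator rS.integrand) (KZlog.band rB.domain a b) :=
    ((integrable_indicator_iff hmeasS).2 rS.integrableOn).integrableOn
  obtain ⟨R, hRd, hRi⟩ : ∃ R : IntegralRep 2, R.domain = KZlog.band rB.domain a b ∧
      R.integrand = rS.domain.indicator rS.integrand :=
    ⟨⟨_, _, hDsa, hGsa, hGint⟩, rfl, rfl⟩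
  -- (i) `[R] − [rS]`: domain additivity with a one-piece family and a null remainder
  have h1 : of R - of rS ∈ relations := by
    have key := of_sub_sum_of_mem_relations_of_subset (Finset.univ : Finset Unit) R (fun _ => rS)
      (fun _ _ z hz => by rw [hRd]; exact hSD hz)
      (fun _ _ z hz => by rw [hRi, Set.indicator_of_mem hz]) ?_
      (Set.subsingleton_of_subsingleton.pairwise _)
    · simpa using key
    · have hU : (⋃ i ∈ (Finset.univ : Finset Unit), ((fun _ : Unit => rS) i).domain) = rS.domain := by
        ext z
        simp
      rw [hU, hRd]
      exact hnull
  -- (ii) `[R] − [rB]`: ONE Newton–Leibniz move with primitive `F(x, x') = -Q(x')/√f(x)`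
  have hZ1 : IsSemialgebraicFunOn ℚ (KZlog.band rB.domain a b) (fun z => z 1) :=
    (isSemialgebraicFunOn_aeval hDsa (X 1 : MvPolynomial (Fin 2) ℚ)).congr fun z _ => by simp
  have hproj : IsSemialgebraicMapOn ℚ (KZlog.band rB.domain a b) (fun z (_ : Fin 1) => z 1) :=
    IsSemialgebraicMapOn.of_forall hDsa fun _ => hZ1
  have hQD : IsSemialgebraicFunOn ℚ (KZlog.band rB.domain a b) (fun z => Q (z 1)) :=
    IsSemialgebraicFunOn.comp_isSemialgebraicMapOn_holds (g := fun t : Fin 1 → ℝ => Q (t 0)) hQ hproj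
      fun z hz => hDJ z hz
  have hsqD : IsSemialgebraicFunOn ℚ (KZlog.band rB.domain a b) (fun z => Real.sqrt (f (z 0))) :=
    isSemialgebraicFunOn_sqrt_cubic_apply hDsa h₂ h₃ hf 0
  have hsq_pos : ∀ z ∈ KZlog.band rB.domain a b, 0 < Real.sqrt (f (z 0)) := fun z hz =>
    Real.sqrt_pos.2 (hpos _ (hA (hDA z hz)))
  have hFsa : IsSemialgebraicFunOn ℚ R.domain F := by
    rw [hRd]
    exact (hQD.neg.div hsqD fun z hz => (hsq_pos z hz).ne').congr fun z _ => by
      simp only [hF, Pi.neg_apply]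
  have hFfib : ∀ x : Fin 1 → ℝ, (fun s : ℝ => F (Fin.snoc x s)) =
      fun s => -Q s / Real.sqrt (f (x 0)) := fun x => by
    ext s
    simp only [hF, hsnoc0, hsnoc1]
  have hcont : ∀ x ∈ rB.domain, ContinuousOn (fun t : ℝ => F (Fin.snoc x t)) (Icc (a x) (b x)) := by
    intro x hx
    rw [hFfib]
    exact ((hQc (x 0) ((hmemB x).1 hx)).neg).div_const _
  have hder : ∀ x ∈ rB.domain, ∀ t ∈ Ioo (a x) (b x),
      HasDerivAt (fun s : ℝ => F (Fin.snoc x s)) (R.integrand (Fin.snoc x t)) t := by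
    intro x hx t ht
    have hxA : x 0 ∈ A := (hmemB x).1 hx
    have ht' : c (x 0) < t ∧ t < d (x 0) := ht
    have hmemt : (Fin.snoc x t : Fin 2 → ℝ) ∈ rS.domain := by
      rw [hmemS]
      simp only [hsnoc0, hsnoc1]
      exact ⟨hxA, ht'.1, ht'.2⟩
    have hRint : R.integrand (Fin.snoc x t) = k t / (Real.sqrt (f (x 0)) * Real.sqrt (f t)) := by
      rw [hRi, Set.indicator_of_mem hmemt, hSi hmemt]
      simp only [hsnoc0, hsnoc1]
    rw [hRint, hFfib]
    have key : HasDerivAt (fun s : ℝ => -Q s / Real.sqrt (f (x 0)))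
        (-(-(k t / Real.sqrt (f t))) / Real.sqrt (f (x 0))) t :=
      ((hQd (x 0) hxA t ht').neg).div_const _
    refine key.congr_deriv ?_
    rw [neg_neg, div_div, mul_comm]
  have hbase : ∀ x ∈ rB.domain, rB.integrand x = F (Fin.snoc x (b x)) - F (Fin.snoc x (a x)) := by
    intro x hx
    rw [hBi hx]
    simp only [hF, ha, hb, hsnoc0, hsnoc1]
    ring
  have h2 : of R - of rB ∈ relations :=
    newtonLeibnizRel_subset_relations
      ⟨1, R, rB, a, b, F, hFsa, hasa, hbsa, hab, hRd, hcont, hder, hbase, rfl⟩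
  -- assemble
  have e : of rS - of rB = (of R - of rB) - (of R - of rS) := by abel
  rw [e]
  exact relations.sub_mem h2 h1

end Summit.KontsevichZagierPeriods.KontsevichZagierPeriods.Cruxes.NeronTorsionSector.Translation

end
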